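import Mathlib
import HarnessLib
import Summits.ABC.ABC.Theses.CongruentialReceptacle

/-!
# Crux `ReceptacleIdentity` (stmt-ABC-1813), line `stable-szpiro-duality`: objects of the line

Definitions used by the checked skeleton `Cruxes/ReceptacleIdentity/Lines/stable_szpiro_duality.lean`
(crux-plan by planner-cruxplan-stmt-ABC-1813-stable-szpiro-dualit-0, lead prover-line-stmt-ABC-1813-a1-0,
registered with `ledger skeleton check`, 2026-08-17) and by the files that prove its registered stubs.  They
are moved here verbatim from the skeleton (CONVENTIONS §6: route-posited objects live in a reviewed `…Defs`
file, never in a proof file), so that the stub files and the closing file share ONE vocabulary.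

The crux item stmt-ABC-1813 is informal; its typed face is the route decl
`Summit.ABC.ABC.Theses.CongruentialReceptacle.TameLocalReceptacle` (stmt-ABC-14354).  The line dualises that
decl: the crux's table `t(p; i,j,k; r,s,z)` is a linear functional on formal sums of TAME DATA, and the crux
at one `(κ, ε)` implies STABLE SZPIRO at `(κ, ε)` — `Φ(∂F) ≤ c₃ ‖F‖₁` for every finitely supported signed
family `F` of `κ`-balanced abc-triples.  On residue-MATCHED families (`∂F ≥ 0`) `Φ` is linear,
`Φ(∂F) = c₁ Σ_T w_T s_T` with `s_T = 2 log(abc) − (6+ε) log rad(abc)`, so one matched family of unbounded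
ratio refutes the typed crux.

Contents (all verbatim from the skeleton):
* `Datum`, `datumAt`, `Datum.eval`, `tripleSum_eq` — the tame-data complex and the crux's triple sum;
* `lowerW`, `upperW`, `boundary`, `Phi` — the crux's windows, `∂T`, and the box functional `Φ`;
* `SignedFamily κ` with `bdry`, `l1`, `linGain`, `Matched`; `szpiroExcess`;
* `TameLocalReceptacleAt κ ε` (the crux's body at one `(κ, ε)`; `tameLocalReceptacle_iff` is `Iff.rfl`),
  `StableSzpiroAt`, `StableSzpiro`, `MatchedFreeLunch`, `FreeLunchBeyondSingletons`,
  `matchedFreeLunch_of_beyondSingletons`;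
* the line's typed target `NotTameLocalReceptacle := ¬ TameLocalReceptacle`.

No theorem of substance is proved here; the registered stubs (`stub_stableSzpiroAt_of_tameLocalReceptacleAt`,
`stub_phi_eq_linGain_of_matched`, `stub_matchedFreeLunch`) land in their own files `--supports stmt-ABC-1813`.
-/

-- `Summit.<Summit>.<Problem>` is the mandated summit-side namespace (CONVENTIONS §2); for the
-- single-conjunct summit `ABC` the two coincide, so the duplicate `ABC.ABC` is deliberate.
set_option linter.dupNamespace false

namespace Summit.ABC.ABC.Theorems.StableSzpiro

open Literature.NumberTheory.DiophantineGeometry (IsABCTriple rad)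
open Summit.ABC.ABC.Theses.CongruentialReceptacle
open Finset

noncomputable section

/-! ### The tame-data complex -/

/-- A tame datum `(p; i,j,k; r,s,z)` — literally the seven arguments of the crux's table
`t p i j k r s z` (`i,j,k = v_p a, v_p b, v_p c`; `r,s,z` = the `p`-free parts of `a,b,c` mod `p`). -/
structure Datum where
  /-- the prime -/
  p : ℕ
  /-- `v_p a` -/
  i : ℕ
  /-- `v_p b` -/
  j : ℕ
  /-- `v_p c` -/
  k : ℕ
  /-- `a / p^{v_p a} mod p` -/
  r : ℕ
  /-- `b / p^{v_p b} mod p` -/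
  s : ℕ
  /-- `c / p^{v_p c} mod p` -/
  z : ℕ

/-- The tame datum `D_p(a,b,c)` of the triple `(a,b,c)` at the prime `p`, with exactly the
expressions the crux `TameLocalReceptacle` feeds to its table. -/
def datumAt (a b c p : ℕ) : Datum where
  p := p
  i := a.factorization p
  j := b.factorization p
  k := c.factorization p
  r := a / p ^ a.factorization p % p
  s := b / p ^ b.factorization p % p
  z := c / p ^ c.factorization p % p

/-- Evaluate a curried table (the crux's `t : ℕ → ℕ → ℕ → ℕ → ℕ → ℕ → ℕ → ℤ`) at a datum. -/
def Datum.eval (t : ℕ → ℕ → ℕ → ℕ → ℕ → ℕ → ℕ → ℤ) (d : Datum) : ℤ :=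
  t d.p d.i d.j d.k d.r d.s d.z

/-- The crux's triple sum `Σ_{p ∣ abc} t(p; D_p)` is the sum of `t` over the data of the triple
(definitional; pins the field order of `datumAt` to the crux's argument order). [folklore] -/
theorem tripleSum_eq (t : ℕ → ℕ → ℕ → ℕ → ℕ → ℕ → ℕ → ℤ) (a b c : ℕ) :
    (∑ p ∈ (a * b * c).primeFactors, (datumAt a b c p).eval t) =
      ∑ p ∈ (a * b * c).primeFactors, t p (a.factorization p) (b.factorization p)
        (c.factorization p) (a / p ^ a.factorization p % p) (b / p ^ b.factorization p % p)
        (c / p ^ c.factorization p % p) :=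
  rfl

/-- Lower window of the crux at a datum: `c₁ (2(i+j+k) − 6 − ε) log p` (verbatim the crux's). -/
def lowerW (c₁ ε : ℝ) (d : Datum) : ℝ :=
  c₁ * (2 * ((d.i + d.j + d.k : ℕ) : ℝ) - 6 - ε) * Real.log d.p

/-- Upper window of the crux at a datum: `c₁′ ((i+j+k) + 1) log p` (verbatim the crux's bound on `|t|`). -/
def upperW (c₁' : ℝ) (d : Datum) : ℝ :=
  c₁' * (((d.i + d.j + d.k : ℕ) : ℝ) + 1) * Real.log d.p

/-- `∂T`: the formal sum (multiplicity one each) of the local classes of the triple `(a,b,c)`. -/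
def boundary (a b c : ℕ) : Datum →₀ ℝ :=
  ∑ p ∈ (a * b * c).primeFactors, Finsupp.single (datumAt a b c p) 1

/-- `Φ_{c₁,c₁′,ε}(μ) = Σ_d μ(d)⁺·lowerW(d) − μ(d)⁻·upperW(d)`: the minimum of `⟨μ, t⟩` over real tables
`t` with `lowerW ≤ t ≤ upperW` pointwise (the box minimum; on `μ ≥ 0` it is `Σ_d μ(d)·lowerW(d)`). -/
def Phi (c₁ c₁' ε : ℝ) (μ : Datum →₀ ℝ) : ℝ :=
  μ.sum fun d m => max m 0 * lowerW c₁ ε d - max (-m) 0 * upperW c₁' d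

/-- A finitely supported SIGNED FAMILY of κ-balanced abc-triples: real weights `w` on a finite set
`supp` of ordered triples `(a, b, c)`, each an abc-triple with `κc ≤ a` and `κc ≤ b`. -/
structure SignedFamily (κ : ℝ) where
  /-- the finite support: ordered triples `(a, b, c)` -/
  supp : Finset (ℕ × ℕ × ℕ)
  /-- the real weights -/
  w : ℕ × ℕ × ℕ → ℝ
  /-- every triple in the support is a `κ`-balanced abc-triple -/
  balanced : ∀ T ∈ supp, IsABCTriple T.1 T.2.1 T.2.2 ∧
    κ * (T.2.2 : ℝ) ≤ (T.1 : ℝ) ∧ κ * (T.2.2 : ℝ) ≤ (T.2.1 : ℝ)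

variable {κ : ℝ}

/-- `∂F = Σ_T w_T · ∂T`. -/
def SignedFamily.bdry (F : SignedFamily κ) : Datum →₀ ℝ :=
  ∑ T ∈ F.supp, F.w T • boundary T.1 T.2.1 T.2.2

/-- `‖F‖₁ = Σ_T |w_T|`. -/
def SignedFamily.l1 (F : SignedFamily κ) : ℝ :=
  ∑ T ∈ F.supp, |F.w T|

/-- The (signed) Szpiro excess of one triple: `s_T = 2 log(abc) − (6+ε) log rad(abc)`;
`s_T ≤ log C` for all κ-balanced triples is exactly `BalancedFreySzpiro` at `(κ, ε)`. -/
def szpiroExcess (ε : ℝ) (a b c : ℕ) : ℝ :=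
  2 * Real.log ((a * b * c : ℕ) : ℝ) - (6 + ε) * Real.log ((rad a b c : ℕ) : ℝ)

/-- The linear gain `Σ_T w_T · s_T` of a signed family. -/
def SignedFamily.linGain (ε : ℝ) (F : SignedFamily κ) : ℝ :=
  ∑ T ∈ F.supp, F.w T * szpiroExcess ε T.1 T.2.1 T.2.2

/-- MATCHED (residue-matched) family: `∂F ≥ 0` — every local class of a negatively weighted triple
is covered, with multiplicity, by the same class (same prime, valuations AND residues) of positively
weighted triples. -/
def SignedFamily.Matched (F : SignedFamily κ) : Prop :=
  ∀ d : Datum, 0 ≤ F.bdry d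

/-! ### The statements -/

/-- The crux `TameLocalReceptacle` at one `(κ, ε)`: verbatim its body after `∀ κ > 0, ∀ ε > 0`
(see `tameLocalReceptacle_iff`). -/
def TameLocalReceptacleAt (κ ε : ℝ) : Prop :=
  ∃ c₁ c₁' c₃ : ℝ, 0 < c₁ ∧ ∃ m₀ : ℕ, ∀ ℓ n : ℕ, ℓ.Prime → 5 ≤ ℓ → m₀ ≤ ℓ ^ n →
    ∃ t : ℕ → ℕ → ℕ → ℕ → ℕ → ℕ → ℕ → ℤ,
      (∀ p i j k r s z : ℕ, p.Prime →
        c₁ * (2 * ((i + j + k : ℕ) : ℝ) - 6 - ε) * Real.log p ≤ (t p i j k r s z : ℝ) ∧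
        |(t p i j k r s z : ℝ)| ≤ c₁' * (((i + j + k : ℕ) : ℝ) + 1) * Real.log p) ∧
      ∀ a b c : ℕ, IsABCTriple a b c → κ * (c : ℝ) ≤ (a : ℝ) → κ * (c : ℝ) ≤ (b : ℝ) →
        ¬ ℓ ∣ a * b * c → ∃ B : ℤ, |(B : ℝ)| ≤ c₃ ∧
          (∑ p ∈ (a * b * c).primeFactors, t p (a.factorization p) (b.factorization p)
            (c.factorization p) (a / p ^ a.factorization p % p) (b / p ^ b.factorization p % p)
            (c / p ^ c.factorization p % p)) ≡ B [ZMOD ((ℓ ^ n : ℕ) : ℤ)]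

/-- The route decl IS the `∀ κ > 0, ∀ ε > 0` closure of `TameLocalReceptacleAt` (definitional). [folklore] -/
theorem tameLocalReceptacle_iff :
    TameLocalReceptacle ↔ ∀ κ : ℝ, 0 < κ → ∀ ε : ℝ, 0 < ε → TameLocalReceptacleAt κ ε :=
  Iff.rfl

/-- Registered prelude stub of the line (the same definitional equivalence, under its registered
name): the route decl is the `(κ, ε)`-closure of `TameLocalReceptacleAt`. [folklore] -/
theorem stub_tameLocalReceptacle_iff :
    TameLocalReceptacle ↔ ∀ κ : ℝ, 0 < κ → ∀ ε : ℝ, 0 < ε → TameLocalReceptacleAt κ ε :=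
  tameLocalReceptacle_iff

/-- STABLE SZPIRO at `(κ, ε)` — the exact real dual of the tame-local receptacle: a linear
isoperimetric inequality `Φ(∂F) ≤ c₃ ‖F‖₁` for every signed family of κ-balanced abc-triples.
At `‖F‖₁ = 1` (singleton families) it is `BalancedFreySzpiro` at `(κ, ε)` with `C = exp(c₃/c₁)`. -/
def StableSzpiroAt (κ ε : ℝ) : Prop :=
  ∃ c₁ c₁' c₃ : ℝ, 0 < c₁ ∧ ∀ F : SignedFamily κ, Phi c₁ c₁' ε F.bdry ≤ c₃ * F.l1

/-- STABLE SZPIRO (all `κ, ε`). -/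
def StableSzpiro : Prop :=
  ∀ κ : ℝ, 0 < κ → ∀ ε : ℝ, 0 < ε → StableSzpiroAt κ ε

/-- MATCHED FREE LUNCH at `(κ, ε)`: matched families of unbounded ratio `Σ_T w_T s_T / ‖F‖₁`
(`sup_X s*(X) = ∞` for the line's one-sided LP). -/
def MatchedFreeLunch (κ ε : ℝ) : Prop :=
  ∀ C : ℝ, ∃ F : SignedFamily κ, F.Matched ∧ C * F.l1 < F.linGain ε

/-- The abc-FREE form: the ratio stays unbounded after every positively weighted triple is refunded
its own positive Szpiro excess — cancellation between DIFFERENT triples alone manufactures the gain.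
Implies `MatchedFreeLunch` (`matchedFreeLunch_of_beyondSingletons`). -/
def FreeLunchBeyondSingletons (κ ε : ℝ) : Prop :=
  ∀ C : ℝ, ∃ F : SignedFamily κ, F.Matched ∧
    C * F.l1 + (∑ T ∈ F.supp, |F.w T| * max (szpiroExcess ε T.1 T.2.1 T.2.2) 0) < F.linGain ε

/-- The line's typed target: the typed face of the crux is false. -/
def NotTameLocalReceptacle : Prop :=
  ¬ TameLocalReceptacle

/-- The abc-free certificate form implies the registered one (the refunded excesses are `≥ 0`). [folklore] -/
theorem matchedFreeLunch_of_beyondSingletons {κ ε : ℝ} (h : FreeLunchBeyondSingletons κ ε) :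
    MatchedFreeLunch κ ε := by
  intro C
  obtain ⟨F, hM, hlt⟩ := h C
  refine ⟨F, hM, lt_of_le_of_lt ?_ hlt⟩
  have : 0 ≤ ∑ T ∈ F.supp, |F.w T| * max (szpiroExcess ε T.1 T.2.1 T.2.2) 0 :=
    Finset.sum_nonneg fun T _ => mul_nonneg (abs_nonneg _) (le_max_right _ _)
  linarith

/-- The empty family has zero boundary, norm and gain — so every `MatchedFreeLunch` witness is a
genuine (non-empty) family. [folklore] -/
theorem empty_family_trivial (ε : ℝ) (F : SignedFamily κ) (h : F.supp = ∅) :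
    F.bdry = 0 ∧ F.l1 = 0 ∧ F.linGain ε = 0 := by
  simp [SignedFamily.bdry, SignedFamily.l1, SignedFamily.linGain, h]

/-- `Φ` of the zero class is `0`. [folklore] -/
theorem Phi_zero (c₁ c₁' ε : ℝ) : Phi c₁ c₁' ε 0 = 0 := by
  simp [Phi]

end

end Summit.ABC.ABC.Theorems.StableSzpiro
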